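import Literature.NumberTheory.QuadraticFields.RealQuadraticClassNumberOneInert
import Literature.NumberTheory.QuadraticFields.RealQuadraticClassNumber1365
import HarnessLib

/-!
# Class number one by Minkowski's bound when every small prime is inert OR the norm of an element
# (`d_K = 9173`, the all-inert ladder rung `D_19^+ = D_23^+`)

Topic `NumberTheory/QuadraticFields`, namespace `Literature.NumberTheory.QuadraticFields.Quadratic`; joins
`RealQuadraticClassNumberOneInert.lean` (all primes below `M_K` inert ⇒ `h_K = 1`) with the split/ramified device of
`RealQuadraticClassNumberOneSmall.lean` (`isPrincipal_of_absNorm_eq_of_normForm`: if the norm form takes `±p`, every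
ideal of norm `p` is principal), in the NORMALISED basis `ω² = ω + (d_K − 1)/4` of
`RealQuadraticClassNumber1365.lean` (`exists_basis_sq_eq_add_of_emod_four_eq_one`), so that the hypotheses are
plain integer arithmetic on `d_K`. Everything here is PROVED (theorems only; no definition, no named fact).

* **`classNumber_eq_one_of_prime_cases`** — `[K:ℚ] = 2`, `0 < d_K < 4(y+1)²`, `d_K ≡ 1 (mod 4)`, and for every
  prime `p ≤ y`: `p = 2` with `d_K ≡ 5 (mod 8)` (inert), or `p` odd with `(d_K/p) = −1` (inert), or
  `|x² + xz − ((d_K − 1)/4) z²| = p` for some integers `x, z` (`p` is a norm) ⇒ `h_K = 1`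
  (Marcus, *Number Fields*, Ch. 5, Cor. 2 of Thm. 37 and the examples after it: every prime `𝔭` with `N𝔭 ≤ M_K` is
  `(p)` or `(x + zω)` or its conjugate);
* **`classNumber_eq_one_of_discr_eq_9173`** — `h(ℚ(√9173)) = 1`: `M_K = √9173/2 = 47.89 < 48`; the primes
  `≤ 23` and `41` are inert (`9173 = D_19^+ = D_23^+` of the least-all-inert ladder, Lehmer–Lehmer–Shanks), and
  with `ω² = ω + 2293`: `N(237 + 5ω) = 29`, `N(853 + 18ω) = 31`, `N(47 + ω) = −37`, `N(95 + 2ω) = 43`,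
  `N(142 + 3ω) = −47`;
* **`QuadIrr.fundUnit_eq_of_no_small_unit`** — a SMALL finite check for the fundamental unit: if `(t, u)` solves
  `t² − Du² = ±4` and NO solution `(G, B)` has `G² < 4(t+1)`, `DB² < 4(t+1)` (a box of size `≈ 2√t × 2√(t/D)`),
  then `ε_D = (t + u√D)/2` — because every solution is a power `εᵏ` (`QuadIrr.exists_eq_fundUnit_pow`), and `k ≥ 2`
  would put `ε ≤ √η ≤ √(t+1)` inside the box; this replaces the `u × (Du + 2)` box of
  `RealQuadraticFundamentalUnitValues.fundUnit_eq_of_check`, hopeless for `u = 2725`;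
* `QuadIrr.fundUnit_9173 = (260989 + 2725√9173)/2` (box `10 × 1021`, `decide`), `regulator_of_discr_eq_9173`,
  `classNumber_mul_regulator_of_discr_eq_9173` (`h_K R_K = log ε₉₁₇₃`).

First consumer: the landau-siegel rescue bed (`Zhang2022/RepairBedClassNumberFormulaReal.lean`: `L(1, χ₉₁₇₃)`).
Not here: the rungs `24653` (`h = 4`), `74093`, `170957`, `214037`.

## References

* [Marcus1977] D. A. Marcus, *Number Fields*, Ch. 5, Cor. 2 of Thm. 37 and the examples following it.
* [LehmerLehmerShanks1970] D. H. Lehmer, E. Lehmer, D. Shanks, *Integer sequences having prescribed quadratic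
  character*, Math. Comp. 24 (1970) 433–451, §1.
* [JacobsonWilliams2008] M. J. Jacobson, H. C. Williams, *Solving the Pell Equation* (2008), §3.3, §4.3, §5.3.
-/

noncomputable section

open Module NumberField NumberField.InfinitePlace Ideal
open scoped nonZeroDivisors

namespace Literature.NumberTheory.QuadraticFields

namespace Quadratic

variable {K : Type*} [Field K] [NumberField K]

/-- **`h_K = 1` by Minkowski when every prime below the bound is inert or a norm.** Let `[K : ℚ] = 2`,
`0 < d_K < 4(y+1)²`, `d_K ≡ 1 (mod 4)`, and suppose that every prime `p ≤ y` is either `2` with `d_K ≡ 5 (mod 8)`,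
or odd with `(d_K/p) = −1`, or satisfies `|x² + xz − ((d_K−1)/4)z²| = p` for some `x, z ∈ ℤ`. Then `h_K = 1`: in the
normalised basis `ω² = ω + (d_K−1)/4` a prime `𝔭` above such a `p` is `(p)` (inert), or has norm `p` and is `(x + zω)`
or `(x + z − zω)`, or has norm `p²` and is `(p)`. [cite: Marcus1977, Ch. 5, Cor. 2 of Thm. 37 and the examples after it] -/
theorem classNumber_eq_one_of_prime_cases (h2 : finrank ℚ K = 2) (hd : 0 < NumberField.discr K)
    (h1 : NumberField.discr K % 4 = 1) {y : ℕ} (hy : NumberField.discr K < 4 * ((y : ℤ) + 1) ^ 2)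
    (hp : ∀ p : ℕ, p.Prime → p ≤ y →
      (p = 2 ∧ NumberField.discr K % 8 = 5) ∨ (p ≠ 2 ∧ jacobiSym (NumberField.discr K) p = -1) ∨
        ∃ x z : ℤ, (x ^ 2 + 1 * x * z - (NumberField.discr K - 1) / 4 * z ^ 2).natAbs = p) :
    NumberField.classNumber K = 1 := by
  obtain ⟨-, hc0⟩ := nrRealPlaces_eq_two_and_nrComplexPlaces_eq_zero h2 hd
  obtain ⟨b, hb, hω⟩ := exists_basis_sq_eq_add_of_emod_four_eq_one h2 h1
  have hdisc : NumberField.discr K = 1 ^ 2 + 4 * ((NumberField.discr K - 1) / 4) := by omega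
  -- `ω` is a root of `X² − X − (d−1)/4`
  have hrel : (b 1) ^ 2 + ((-(1 : ℤ) : ℤ) : 𝓞 K) * b 1 + ((-((NumberField.discr K - 1) / 4) : ℤ) : 𝓞 K) = 0 := by
    rw [sq]
    push_cast at hω ⊢
    linear_combination hω
  -- the Minkowski bound
  have hfloor : ⌊(4 / Real.pi) ^ nrComplexPlaces K *
      ((finrank ℚ K).factorial / (finrank ℚ K : ℝ) ^ finrank ℚ K *
        Real.sqrt |(NumberField.discr K : ℝ)|)⌋₊ ≤ y := by
    rw [hc0, h2, pow_zero, one_mul]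
    have hd' : |(NumberField.discr K : ℝ)| < 4 * ((y : ℝ) + 1) ^ 2 := by
      rw [abs_of_pos (by exact_mod_cast hd)]
      exact_mod_cast hy
    have hsqrt : Real.sqrt |(NumberField.discr K : ℝ)| < 2 * ((y : ℝ) + 1) := by
      rw [Real.sqrt_lt' (by positivity)]
      nlinarith
    have hfac : ((2 : ℕ).factorial : ℝ) = 2 := by norm_num [Nat.factorial]
    rw [hfac]
    refine Nat.le_of_lt_succ ((Nat.floor_lt (by positivity)).mpr ?_)
    calc 2 / (2 : ℝ) ^ 2 * Real.sqrt |(NumberField.discr K : ℝ)| < 2 / (2 : ℝ) ^ 2 * (2 * ((y : ℝ) + 1)) := by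
          gcongr
      _ = (y.succ : ℝ) := by push_cast; ring
  rw [NumberField.classNumber_eq_one_iff]
  refine RingOfIntegers.isPrincipalIdealRing_of_isPrincipal_of_pow_le_of_mem_primesOver_of_mem_Icc
    fun p hpI hprime P hP _ => ?_
  have hpy : p ≤ y := (Finset.mem_Icc.mp hpI).2.trans hfloor
  rcases hp p hprime hpy with ⟨rfl, h8⟩ | ⟨-, hj⟩ | ⟨x, z, hxz⟩
  · exact isPrincipal_of_mem_primesOver_of_no_root h2 hrel Nat.prime_two
      (no_root_two_of_emod_eight (by rw [← hdisc]; exact h8)) hP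
  · exact isPrincipal_of_mem_primesOver_of_no_root h2 hrel hprime
      (no_root_of_jacobiSym_eq_neg_one hprime (by rw [← hdisc]; exact hj)) hP
  · -- `p` is a norm: a prime above `p` has norm `p` (then principal by the norm form) or `p²` (then `= (p)`)
    obtain ⟨hPprime, hPover⟩ := hP
    have hpP : (p : 𝓞 K) ∈ P := by
      have h1 : (p : ℤ) ∈ P.under ℤ := by
        rw [← hPover.over]
        exact Ideal.mem_span_singleton_self _
      rw [Ideal.under_def, Ideal.mem_comap, map_natCast] at h1
      exact h1
    have hle : span {(p : 𝓞 K)} ≤ P := (span_singleton_le_iff_mem _).mpr hpP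
    have hNp : absNorm (span {(p : 𝓞 K)}) = p ^ 2 := by
      rw [Ideal.absNorm_span_natCast, NumberField.RingOfIntegers.rank, h2]
    have hdvd : absNorm P ∣ p ^ 2 := hNp ▸ absNorm_dvd_absNorm_of_le hle
    obtain ⟨i, hi, hieq⟩ := (Nat.dvd_prime_pow hprime).mp hdvd
    interval_cases i
    · exact absurd (absNorm_eq_one_iff.mp (by rw [hieq, pow_zero])) hPprime.ne_top
    · rw [pow_one] at hieq
      exact isPrincipal_of_absNorm_eq_of_normForm b hb hω hprime hxz hieq
    · have hPeq := eq_of_le_of_absNorm_eq hle (by rw [hNp, hieq])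
        (by rw [hNp]; exact pow_ne_zero 2 hprime.ne_zero)
      exact ⟨⟨p, by rw [← hPeq, submodule_span_eq]⟩⟩

/-- **`h(ℚ(√9173)) = 1`** (`9173` prime, the rung `D_19^+ = D_23^+` of the all-inert ladder): `M_K = √9173/2 < 48`;
`2, 3, …, 23` and `41` are inert; the split primes `29, 31, 37, 43, 47 ≤ 47` are norms from `ℤ[ω]`, `ω² = ω + 2293`:
`N(237 + 5ω) = 29`, `N(853 + 18ω) = 31`, `N(47 + ω) = −37`, `N(95 + 2ω) = 43`, `N(142 + 3ω) = −47`.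
[cite: LehmerLehmerShanks1970, §1] -/
theorem classNumber_eq_one_of_discr_eq_9173 (h2 : finrank ℚ K = 2) (hd : NumberField.discr K = 9173) :
    NumberField.classNumber K = 1 := by
  refine classNumber_eq_one_of_prime_cases h2 (by rw [hd]; norm_num) (by rw [hd]; rfl) (y := 47)
    (by rw [hd]; norm_num) fun p hp hp47 => ?_
  rw [hd]
  interval_cases p
  all_goals first
    | exact absurd hp (by decide)
    | skip
  · exact Or.inl ⟨rfl, by norm_num⟩
  · exact Or.inr (Or.inl ⟨by decide, by norm_num⟩) -- p = 3 inert
  · exact Or.inr (Or.inl ⟨by decide, by norm_num⟩) -- p = 5 inert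
  · exact Or.inr (Or.inl ⟨by decide, by norm_num⟩) -- p = 7 inert
  · exact Or.inr (Or.inl ⟨by decide, by norm_num⟩) -- p = 11 inert
  · exact Or.inr (Or.inl ⟨by decide, by norm_num⟩) -- p = 13 inert
  · exact Or.inr (Or.inl ⟨by decide, by norm_num⟩) -- p = 17 inert
  · exact Or.inr (Or.inl ⟨by decide, by norm_num⟩) -- p = 19 inert
  · exact Or.inr (Or.inl ⟨by decide, by norm_num⟩) -- p = 23 inert
  · exact Or.inr (Or.inr ⟨237, 5, by norm_num⟩) -- p = 29: N(237 + 5ω) = 29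
  · exact Or.inr (Or.inr ⟨853, 18, by norm_num⟩) -- p = 31: N(853 + 18ω) = 31
  · exact Or.inr (Or.inr ⟨47, 1, by norm_num⟩) -- p = 37: N(47 + ω) = −37
  · exact Or.inr (Or.inl ⟨by decide, by norm_num⟩) -- p = 41 inert
  · exact Or.inr (Or.inr ⟨95, 2, by norm_num⟩) -- p = 43: N(95 + 2ω) = 43
  · exact Or.inr (Or.inr ⟨142, 3, by norm_num⟩) -- p = 47: N(142 + 3ω) = −47

end Quadratic

namespace QuadIrr

/-- **Fundamental unit by a SMALL finite check.** Let `D ≥ 9` be a non-square, `D ≡ 0, 1 (mod 4)`, and let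
`t, u ≥ 1` solve `t² − Du² = ±4`, so that `η = (t + u√D)/2 = ε_Dᵏ` for some `k ≥ 1`
(`exists_eq_fundUnit_pow`). If `k ≥ 2` then `ε_D² ≤ η ≤ t + 1`, and writing `ε_D = (G + B√D)/2` with `G, B ≥ 1`
(`exists_fundUnit_eq`) gives `G² < 4(t+1)` and `DB² < 4(t+1)`. Hence: if no solution `(G, B)` of `G² − DB² = ±4`
lies in a box `1 ≤ B ≤ B₀`, `1 ≤ G ≤ G₀` with `(G₀+1)² ≥ 4(t+1)` and `D(B₀+1)² ≥ 4(t+1)`, then `ε_D = η`.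
[cite: JacobsonWilliams2008, §3.3 pp. 58–59 with §5.3 (5.33)] -/
theorem fundUnit_eq_of_no_small_unit {D : ℕ} (hD : ¬ IsSquare D) (hD4 : D % 4 = 0 ∨ D % 4 = 1) (h9 : 9 ≤ D)
    {t u : ℕ} (ht : 1 ≤ t) (hu : 1 ≤ u)
    (hsol : (t : ℤ) ^ 2 - D * u ^ 2 = 4 ∨ (t : ℤ) ^ 2 - D * u ^ 2 = -4)
    {G₀ B₀ : ℕ} (hG : 4 * (t + 1) ≤ (G₀ + 1) ^ 2) (hB : 4 * (t + 1) ≤ D * (B₀ + 1) ^ 2)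
    (hcheck : ∀ B ∈ Finset.Icc 1 B₀, ∀ G ∈ Finset.Icc 1 G₀,
      ¬ ((G : ℤ) ^ 2 - D * B ^ 2 = 4 ∨ (G : ℤ) ^ 2 - D * B ^ 2 = -4)) :
    fundUnit D = (t + u * Real.sqrt D) / 2 := by
  obtain ⟨k, hk, hpow⟩ := exists_eq_fundUnit_pow hD hD4 h9 (X := t) (Y := u) (by exact_mod_cast ht)
    (by exact_mod_cast hu) hsol
  push_cast at hpow
  by_cases hk1 : k = 1
  · rw [hk1, pow_one] at hpow
    exact hpow.symm
  exfalso
  have hk2 : 2 ≤ k := by omega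
  have h1 : 1 < fundUnit D := one_lt_fundUnit hD hD4
  have hD0 : (0 : ℝ) ≤ Real.sqrt D := Real.sqrt_nonneg _
  -- `ε² ≤ η ≤ t + 1`
  have hη : ((t : ℝ) + u * Real.sqrt D) / 2 ≤ t + 1 := by
    have hsq : ((u : ℝ) * Real.sqrt D) ^ 2 ≤ ((t : ℝ) + 2) ^ 2 := by
      rw [mul_pow, Real.sq_sqrt (by positivity)]
      have : ((u : ℝ)) ^ 2 * D ≤ (t : ℝ) ^ 2 + 4 := by
        rcases hsol with h | h
        · have h' : ((u : ℝ)) ^ 2 * D = (t : ℝ) ^ 2 - 4 := by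
            have := congrArg (Int.cast : ℤ → ℝ) h; push_cast at this; linarith
          linarith
        · have h' : ((u : ℝ)) ^ 2 * D = (t : ℝ) ^ 2 + 4 := by
            have := congrArg (Int.cast : ℤ → ℝ) h; push_cast at this; linarith
          linarith
      have ht0 : (0 : ℝ) ≤ t := Nat.cast_nonneg _
      nlinarith
    have huD : (u : ℝ) * Real.sqrt D ≤ t + 2 :=
      (pow_le_pow_iff_left₀ (by positivity) (by positivity) two_ne_zero).mp hsq
    linarith
  have hε2 : fundUnit D ^ 2 ≤ (t : ℝ) + 1 :=
    (pow_le_pow_right₀ h1.le hk2).trans (hpow ▸ hη)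
  -- `ε = (G + B√D)/2` with `G, B ≥ 1` in the box
  obtain ⟨G, B, hG1, hB1, hGB, hε, -⟩ := exists_fundUnit_eq hD hD4
  obtain ⟨G', rfl⟩ := Int.eq_ofNat_of_zero_le (show (0 : ℤ) ≤ G by omega)
  obtain ⟨B', rfl⟩ := Int.eq_ofNat_of_zero_le (show (0 : ℤ) ≤ B by omega)
  push_cast at hε
  have hGpos : (0 : ℝ) < G' := by exact_mod_cast (show 0 < (G' : ℤ) by omega)
  have hBpos : (0 : ℝ) < B' := by exact_mod_cast (show 0 < (B' : ℤ) by omega)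
  have hDpos : (0 : ℝ) < D := by exact_mod_cast (show 0 < D by omega)
  have hBD : (0 : ℝ) < (B' : ℝ) * Real.sqrt D := mul_pos hBpos (Real.sqrt_pos.mpr hDpos)
  have hGlt : ((G' : ℝ)) ^ 2 < 4 * ((t : ℝ) + 1) := by
    have : (G' : ℝ) < 2 * fundUnit D := by rw [hε]; linarith
    nlinarith
  have hBlt : (D : ℝ) * (B' : ℝ) ^ 2 < 4 * ((t : ℝ) + 1) := by
    have hlt : (B' : ℝ) * Real.sqrt D < 2 * fundUnit D := by rw [hε]; linarith
    have hsq : ((B' : ℝ) * Real.sqrt D) ^ 2 = D * (B' : ℝ) ^ 2 := by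
      rw [mul_pow, Real.sq_sqrt hDpos.le]; ring
    nlinarith
  have hGle : G' ≤ G₀ := by
    have h : (G' : ℝ) ^ 2 < ((G₀ : ℝ) + 1) ^ 2 := hGlt.trans_le (by exact_mod_cast hG)
    have : (G' : ℝ) < G₀ + 1 := (pow_lt_pow_iff_left₀ (by positivity) (by positivity) two_ne_zero).mp h
    exact Nat.lt_succ_iff.mp (by exact_mod_cast this)
  have hBle : B' ≤ B₀ := by
    have h : (D : ℝ) * (B' : ℝ) ^ 2 < D * ((B₀ : ℝ) + 1) ^ 2 := hBlt.trans_le (by exact_mod_cast hB)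
    have h' : (B' : ℝ) ^ 2 < ((B₀ : ℝ) + 1) ^ 2 := lt_of_mul_lt_mul_left h hDpos.le
    have : (B' : ℝ) < B₀ + 1 := (pow_lt_pow_iff_left₀ (by positivity) (by positivity) two_ne_zero).mp h'
    exact Nat.lt_succ_iff.mp (by exact_mod_cast this)
  exact hcheck B' (Finset.mem_Icc.mpr ⟨by omega, hBle⟩) G' (Finset.mem_Icc.mpr ⟨by omega, hGle⟩) hGB

/-- **`ε₉₁₇₃ = fundUnit 9173 = (260989 + 2725·√9173)/2`** (`260989² − 9173·2725² = −4`; no unit in the box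
`B ≤ 10`, `G ≤ 1021`). [cite: JacobsonWilliams2008, §4.3 with §5.3 (5.33)] -/
theorem fundUnit_9173 : fundUnit 9173 = (260989 + 2725 * Real.sqrt 9173) / 2 := by
  have h := fundUnit_eq_of_no_small_unit (D := 9173) (t := 260989) (u := 2725) (G₀ := 1021) (B₀ := 10)
    (by decide +kernel) (by norm_num) (by norm_num) (by norm_num) (by norm_num) (by norm_num) (by norm_num)
    (by norm_num) (by decide +kernel)
  exact_mod_cast h

end QuadIrr

namespace Quadratic

variable {K : Type*} [Field K] [NumberField K]

/-- `d_K = 9173`: `R_K = log ((260989 + 2725√9173)/2)`. [cite: JacobsonWilliams2008, §5.3 (5.33)–(5.34)] -/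
theorem regulator_of_discr_eq_9173 (h2 : finrank ℚ K = 2) (hd : NumberField.discr K = 9173) :
    Units.regulator K = Real.log ((260989 + 2725 * Real.sqrt 9173) / 2) :=
  regulator_eq_log_of_discr_eq h2 (D := 9173) (by exact_mod_cast hd) QuadIrr.fundUnit_9173

/-- `d_K = 9173`: `h_K · R_K = log ((260989 + 2725√9173)/2)`. [cite: LehmerLehmerShanks1970, §1] -/
theorem classNumber_mul_regulator_of_discr_eq_9173 (h2 : finrank ℚ K = 2) (hd : NumberField.discr K = 9173) :
    (NumberField.classNumber K : ℝ) * Units.regulator K = Real.log ((260989 + 2725 * Real.sqrt 9173) / 2) := by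
  rw [classNumber_eq_one_of_discr_eq_9173 h2 hd, regulator_of_discr_eq_9173 h2 hd, Nat.cast_one, one_mul]

end Quadratic

end Literature.NumberTheory.QuadraticFields

end
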